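import Summits.AtomisticToContinuum.Crystallization.Theses.PricedLinkCensus
import Summits.AtomisticToContinuum.Crystallization.Theorems.TruncatedCensusGap.Negative.KappaZeroHalf
import Summits.AtomisticToContinuum.Crystallization.Theorems.TruncatedCensusGap.Negative.WithoutInjective

/-!
# Line `metrical-charge-coercivity` for the crux `PricedLinkCensus.TruncatedCensusGap`
(stmt-AtomisticToContinuum-14230) — crux-plan skeleton, round 1

The crux: `∃ κ > 0, ∀ N (y : Fin N → ℝ³) injective, N · e_χ* + κ · #{i | ¬ IsChargeFree (1/100) y i}
≤ E_χ(y)`, `V_χ = min 1 (max 0 (4 − 2r)) · V_LJ`, `e_χ* = ⨅_Q e_χ(Q)` over `PeriodicConfiguration 3`.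

## The line (idea card `Ideas/metrical-charge-coercivity.md`, triage r1: pass ×3)

Split the charged sites of the crux by ROBUSTNESS IN THE TOLERANCE, at the window `[1/100, 1/50]`:

* `T` (topological charge) — charged at EVERY tolerance `η ∈ [1/100, 1/50]` (free surface, vacancy
  shells, five-rings, grain/twin boundaries, Frank–Kasper sites, and local strain `≥ 2 %`);
* `M` (metrical charge) — charged at `1/100` but charge-free at SOME `η ∈ [1/100, 1/50]`: a pure
  `1 %`-threshold event inside a combinatorially perfect (12 bonds, all rings 4) environment.

`#charged(1/100) = #M + #T` EXACTLY (`card_charged_eq`; `T ⊆ charged` because `1/100 ∈ [1/100, 1/50]`) —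
this replaces the idea card's radius-4 definition of `M` and its false-as-combinatorics counting lemma
(triage r1-1 sharpen 1, r1-2 finding 1): there is no third class to count, and crowding is an ENERGY
matter inside `stub_elasticPricing`.

The five registered stubs:

* `stub_softLinkWindow` (geometry, M–L) — the route's soft link theorem `SoftFourRings` (item 14234:
  `η ≤ 1/100`) EXTENDED to `η ≤ 1/50`: a charge-free link at tolerance `≤ 2 %` is within `nn/4` of a
  rotated cubocta/anticubocta pattern. Implies item 14234 (`softFourRings_of_softLinkWindow`).
* `stub_windowCharts` (geometry, L) — `SoftLinkWindow → WindowCharts`: the route's effective layer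
  propagation `SoftLayerPropagation` (item 14233: one tolerance `η ≤ 1/100` for all sites) EXTENDED to
  per-site tolerances `≤ 1/50` (radius `8·nn_i` clean ⇒ radius `3·nn_i` two-way `nn_i/6`-matched to a
  rigid Barlow stacking at scale `nn_i`). `WindowCharts` implies item 14233
  (`softLayerPropagation_of_windowCharts`).
* `stub_harmonicCoercivity` (certified numerics + transfer matrix, L) — UNIFORM phonon coercivity of
  the `V_χ` Hessian form of EVERY Barlow stacking (arbitrary Hägg word `s`, ideal spacing, scale
  `a ∈ [24/25, 99/100] ∋ a* = 0.977`) on finitely supported displacements, against the nearest-neighbour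
  difference norm; the Hessian kernel `hessV` is the explicit piecewise second variation of
  `V_χ = χ·V_LJ` (`kRad = V_χ''`, `kTan = V_χ'/r`; no `deriv`, no kink is met: all in-range Barlow
  distances `a·{1, √2, √(8/3), √3, √(11/3), 2}` avoid `r ∈ {3/2, 2}` for `a ≤ 99/100`).
* `stub_elasticPricing` (analysis, XL — the line's own engine) —
  `PeriodicStability → WindowCharts → HarmonicCoercivity → MetricalChargeGap`:
  `E_χ(y) − N e_χ* ≥ κ·#M − C·#T` by discrete Friesecke–James–Müller rigidity on the charts (octet-truss
  lock: linear metric control from the combinatorial chart + two-sided bond control), expansion about the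
  LAYER-RELAXED local polytype (first-order term = boundary flux, landing on `T`-sites or on sites within
  `8·nn` of one — `≤ K` per `T`-site at the Lennard-Jones scale, self-paying beyond it), harmonic ⇒
  semi-global coercivity on the `O(η₁)`-basin (THE quantitative bet), the threshold lever (an `M`-site has a
  pair at ratio `∈ (1.01, 1.02]` within graph distance 2: `bondGraph_mono` + Disproof §6
  `dist_le_mul_dist_of_adj`, hence strain `≥ 0.005`), the equation of state along uniform scaling for
  off-scale charts, and Ruelle superstability for crowded sites. Uses `Function.Injective` (honours
  `Negative/WithoutInjective`) and `PeriodicStability` = `BddBelow (range e_χ)` (honours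
  `Negative/KappaZeroHalf`: `e_χ*` is a genuine infimum, `e_χ* ≤ e_χ(polytype)` by `ciInf_le`).
  NEVER compares two different polytypes with each other or with `e_χ*` beyond `ciInf_le`: strain is priced
  against the SAME polytype, so the open energetic content of the crux is not in this stub.
* `stub_topologicalGap` (XL, open-problem content; NOT this line's mechanism — the interface to the
  census price list / card sharp-m-potential-compactness) — `TopologicalChargeGap`: `E_χ − N e_χ* ≥ κ'·#T`.
  Strictly weaker than the crux (`T ⊆ charged`); contains `BddBelow (range e_χ)`
  (`periodicStability_of_topologicalChargeGap`, the Disproof §3 argument) and "hcp-type stackings beat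
  every topologically different periodic competitor by a margin".

Composition (sorry-free): `TruncatedCensusGap_of : Goal.stub_softLinkWindow → Goal.stub_windowCharts →
Goal.stub_harmonicCoercivity → Goal.stub_elasticPricing → Goal.stub_topologicalGap → TruncatedCensusGap`
— periodic stability from the T-gap, charts from the soft link theorem, the M-gap from the engine, then the
convex combination `λ·(M-gap) + (1−λ)·(T-gap)` with `λ = κ'/(2(κ'+C))` and the exact count
`#charged = #M + #T` (`censusGap_of_gaps`).

CALIBRATION (sorry-free, §5): the crux implies BOTH energy stubs
(`metricalChargeGap_of_truncatedCensusGap`, `topologicalChargeGap_of_truncatedCensusGap`), so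
`TruncatedCensusGap ⟺ MetricalChargeGap ∧ TopologicalChargeGap`: the split loses no strength, and the
Disproof §6 witnesses (20 charged sites for `5.4e-4`) are `M`-sites, forcing only `κ_M ≤ 2.7e-5`.

## Disproof used (`Cruxes/TruncatedCensusGap/Disproof.lean`, cdisprove g2; landed `Negative/*` imported)

* `truncatedCensusGap_false_without_injective` (`Negative/WithoutInjective`, p69790): honoured —
  `MetricalChargeGap`, `TopologicalChargeGap` keep `Function.Injective y`; the engine uses it in the
  superstability/crowding step and for `a/2`-separation inside charts.
* `truncatedCensusGap_bddBelow` / `…_kappa_zero_iff_bddBelow` (`Negative/KappaZeroHalf`, p69766):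
  honoured — `PeriodicStability` is an explicit hypothesis of `stub_elasticPricing` and is DERIVED from
  `stub_topologicalGap` in the composition (same two-point argument, `interactionEnergy_truncLJ_pair`).
* §6 `not_isChargeFree_of_short_bond` + NUMERICS (`κ ≤ 2.7e-5`): consistent — every such witness is an
  `M`-site configuration; `κ` of `MetricalChargeGap` is existential (expected `~1e-5`, threshold² × stiffness).
* §7 near-miss (periodic pricing): not needed.
* No `_false_without_` theorem targets a tolerance window or a geometric stub; no landed Negative lemma
  has an instance among the five stubs (checked: the only landed ones are the two above).
-/

noncomputable section

namespace Summit.AtomisticToContinuum.Crystallization.Cruxes.TruncatedCensusGap.MetricalChargeCoercivity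

open Literature.MathematicalPhysics.StatisticalMechanics Literature.Geometry.DiscreteGeometry
open Summit.AtomisticToContinuum.Crystallization.Theses.PricedLinkCensus
  (TruncatedCensusGap SoftFourRings SoftLayerPropagation)
open Summit.AtomisticToContinuum.Crystallization.Theorems
  (interactionEnergy_truncLJ_pair injective_pair_zero_single)

local notation "E³" => EuclideanSpace ℝ (Fin 3)

/-! ## §0 Objects of the crux and of the line -/

/-- The range-2 truncated Lennard-Jones potential of the crux, `V_χ = χ · V_LJ`,
`χ r = min 1 (max 0 (4 − 2r))` (verbatim the crux's inline potential). -/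
def Vχ (r : ℝ) : ℝ := min 1 (max 0 (4 - 2 * r)) * lennardJones r

/-- `e_χ* = ⨅` over periodic configurations of the `V_χ` energy per particle (the crux's constant;
a `Real.iInf`, genuine only under `PeriodicStability`). -/
def eStar : ℝ := ⨅ Q : PeriodicConfiguration 3, Q.energyPerParticle Vχ

/-- TOPOLOGICAL charge: the site is charged at EVERY tolerance of the window `[1/100, 1/50]`. -/
def IsTopo {N : ℕ} (y : Fin N → E³) (j : Fin N) : Prop :=
  ∀ η ∈ Set.Icc (1 / 100 : ℝ) (1 / 50), ¬ IsChargeFree η y j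

/-- METRICAL charge: charged at `1/100`, charge-free at SOME tolerance of the window `[1/100, 1/50]`
(pure threshold charge: the link is combinatorially perfect at that tolerance). -/
def IsMetr {N : ℕ} (y : Fin N → E³) (i : Fin N) : Prop :=
  ¬ IsChargeFree (1 / 100 : ℝ) y i ∧ ∃ η ∈ Set.Icc (1 / 100 : ℝ) (1 / 50), IsChargeFree η y i

/-- Tangential bond stiffness `V_χ'(r) / r`, explicit and piecewise (`V_LJ = r⁻¹²/12 − r⁻⁶/6`,
`V_LJ' = −r⁻¹³ + r⁻⁷`; on `(3/2, 2)`: `(χV)' = −2V + (4 − 2r)V'`; zero beyond the range `2`). -/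
def kTan (r : ℝ) : ℝ :=
  if r < 3 / 2 then (-(r⁻¹) ^ 13 + (r⁻¹) ^ 7) / r
  else if r < 2 then (-2 * lennardJones r + (4 - 2 * r) * (-(r⁻¹) ^ 13 + (r⁻¹) ^ 7)) / r
  else 0

/-- Radial bond stiffness `V_χ''(r)`, explicit and piecewise (`V_LJ'' = 13 r⁻¹⁴ − 7 r⁻⁸`; on
`(3/2, 2)`: `(χV)'' = −4V' + (4 − 2r)V''`; zero beyond `2`). -/
def kRad (r : ℝ) : ℝ :=
  if r < 3 / 2 then 13 * (r⁻¹) ^ 14 - 7 * (r⁻¹) ^ 8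
  else if r < 2 then
    -4 * (-(r⁻¹) ^ 13 + (r⁻¹) ^ 7) + (4 - 2 * r) * (13 * (r⁻¹) ^ 14 - 7 * (r⁻¹) ^ 8)
  else 0

/-- The pair Hessian of `V_χ`: second variation of `V_χ(‖e + t w‖)` at `t = 0`,
`V_χ''(‖e‖) (ê·w)² + (V_χ'(‖e‖)/‖e‖) (‖w‖² − (ê·w)²)`. -/
def hessV (e w : E³) : ℝ :=
  kRad ‖e‖ * (inner ℝ e w / ‖e‖) ^ 2 + kTan ‖e‖ * (‖w‖ ^ 2 - (inner ℝ e w / ‖e‖) ^ 2)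

/-! ## §1 The statements of the line (named `Prop`s) -/

/-- **SOFT LINK THEOREM ON THE WINDOW** (geometry; = route item `SoftFourRings` with the tolerance bound
`1/100` replaced by `1/50`): for every `η ∈ (0, 1/50]` and every site charge-free at `η`, the twelve
points of the fcc or of the hcp kissing pattern, rotated and scaled by `nn_i` about `y_i`, are each within
`nn_i/4` of a site. Why plausible: `η = 0` is Flatley–Tarasov–Taylor–Theil 2013 (24 contacts among twelve
kissing balls only for the two patterns, tree fact `FlatleyEtAl2013_maxContacts`); the √η-soft jitterbug
moves pattern points by `≈ 0.0101·φ`, `φ ≈ √(η/1.02e-4)` degrees: `0.14·nn` at `2 %` `< 1/4`.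
Why it might fail: another 4-regular 12-point near-kissing family at `2 %` farther than `1/4` from both
patterns (12-point semialgebraic search; none known). -/
def SoftLinkWindow : Prop :=
  ∀ η : ℝ, 0 < η → η ≤ 1 / 50 → ∀ (N : ℕ) (y : Fin N → E³) (i : Fin N), IsChargeFree η y i →
    ∃ (A : E³ →ₗᵢ[ℝ] E³) (P : Finset E³), (P = fccKissingPattern ∨ P = hcpKissingPattern) ∧
      ∀ p ∈ P, ∃ j : Fin N, dist (y j) (y i + nearestDist y i • A p) ≤ nearestDist y i / 4

/-- **WINDOW CHARTS** (geometry; = the conclusion of route item `SoftLayerPropagation` under the weaker,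
per-site hypothesis "charge-free at SOME tolerance `≤ 1/50`"): if every site within `8·nn_i` of `y_i` is
charge-free at some tolerance in `(0, 1/50]`, the configuration within `3·nn_i` of `y_i` is two-way
`nn_i/6`-matched to a rigid-motion image of a Barlow stacking `barlowStacking a (a√(2/3)) s`, `a = nn_i`,
`s` a Hägg sequence. Why plausible: each link is a near-kissing 4-regular shell (soft link theorem), the
octet truss between first and second shell is infinitesimally rigid (edge-sharing octahedra lock the
jitterbug LINEARLY in `η`), five shells of margin absorb the scale drift `≤ 2 %`/bond; budget at radius 3:
affine strain `≤ 3 · 0.02 = 0.06` + locked modes `O(η)` `< 1/6`. Why it might fail: a coherent soft mode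
of the two-shell octet-truss piece at `2 %` exceeding `1/6 − 0.06`, or an everywhere-4-ring non-Barlow
cluster at `2 %`. -/
def WindowCharts : Prop :=
  ∀ (N : ℕ) (y : Fin N → E³) (i : Fin N),
    (∀ j : Fin N, dist (y i) (y j) ≤ 8 * nearestDist y i →
      ∃ η : ℝ, 0 < η ∧ η ≤ 1 / 50 ∧ IsChargeFree η y j) →
    ∃ (s : ℤ → ℤ) (g : E³ ≃ᵃⁱ[ℝ] E³), IsHaggSeq s ∧
      (∀ j : Fin N, dist (y i) (y j) ≤ 3 * nearestDist y i →
        ∃ z ∈ barlowStacking (nearestDist y i) (nearestDist y i * Real.sqrt (2 / 3)) s,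
          dist (y j) (g z) ≤ nearestDist y i / 6) ∧
      ∀ z ∈ barlowStacking (nearestDist y i) (nearestDist y i * Real.sqrt (2 / 3)) s,
        dist (y i) (g z) ≤ 3 * nearestDist y i → ∃ j : Fin N, dist (y j) (g z) ≤ nearestDist y i / 6

/-- **UNIFORM HARMONIC COERCIVITY OF THE BARLOW POLYTYPES UNDER `V_χ`** (certified numerics; the idea
card's step (4)): one `κ > 0` such that for EVERY Hägg sequence `s` and every scale `a ∈ [24/25, 99/100]`
(`a* = 0.97707` inside, `−1.7 %`/`+1.3 %`), the second variation of the `V_χ` energy of the ideal stacking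
`S = barlowStacking a (a√(2/3)) s` along any finitely supported displacement `u` dominates `κ` times the
nearest-neighbour difference norm: `κ Σ_{p,q ∈ S, |p−q| ≤ 1.1a} ‖u_p − u_q‖² ≤ ½ Σ_{p ≠ q} hessV(p − q)(u_p − u_q)`.
All sums are finite (finite support, kernel zero beyond `2`). Why plausible: hcp/fcc/dhcp are phonon- and
Born-stable under `V_χ` at `a*` (triage r1-1/r1-3: min `ω²/k² = 2.4/1.7/2.5`, min optical `0.46/0.63/0.26`,
no soft mode); THIS SEAT's kit j013269 computes the constant itself in Bloch form (= the best constant for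
periodic words, by Plancherel): `κ(s, a) = min_k λ_min(D(k) rel. G(k))` for all 13 primitive Hägg words of
period `≤ 6` and 6 seeded random words of period 8/10/12 at `a ∈ {0.96, 0.97, 0.97707, 0.98, 0.99}`:
`κ(s, a*) ∈ [0.414, 0.421]` for EVERY word (spread 1.5 %), `κ_min = 0.335` (hcp, `a = 0.99`, in-plane
acoustic shear), `κ(·, 0.96) ≈ 0.55`; no negative direction anywhere; finite range couples only layers
`m, m±1, m±2` (`2·0.816a < 2.05a < 3·0.816a`), so the form is a finite transfer-matrix family indexed by
5-letter Hägg windows — uniformity in `s` is a finite certified computation (Bloch in-plane, transfer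
along the stacking axis) plus the lattice Korn inequality. Why it might fail: a soft long-period polytype
or scale in the window (none found); the reference is the IDEAL stacking, not the layer-relaxed equilibrium
— residual axial forces are `0` for fcc/hcp/dhcp by symmetry and `≤ 7.3e-3` for the other words
(j013269), entering only `kTan`-type geometric stiffness, `≤ 2 %` of `κ`. -/
def HarmonicCoercivity : Prop :=
  ∃ κ : ℝ, 0 < κ ∧ ∀ s : ℤ → ℤ, IsHaggSeq s → ∀ a : ℝ, 24 / 25 ≤ a → a ≤ 99 / 100 →
    ∀ u : E³ → E³, (Function.support u).Finite →
      Function.support u ⊆ barlowStacking a (a * Real.sqrt (2 / 3)) s →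
      κ * (∑' p : barlowStacking a (a * Real.sqrt (2 / 3)) s,
            ∑' q : barlowStacking a (a * Real.sqrt (2 / 3)) s,
              if dist (p : E³) q ≤ 11 / 10 * a then ‖u p - u q‖ ^ 2 else 0) ≤
        (∑' p : barlowStacking a (a * Real.sqrt (2 / 3)) s,
            ∑' q : barlowStacking a (a * Real.sqrt (2 / 3)) s,
              if (p : E³) ≠ q then hessV ((p : E³) - q) (u p - u q) else 0) / 2

/-- **PERIODIC STABILITY OF `V_χ`**: the energy per particle of periodic configurations is bounded below,
so that `e_χ*` is a genuine infimum (Disproof §3/§5, `Negative/KappaZeroHalf`: the crux implies it and its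
`κ = 0` half is equivalent to it). A hypothesis of the engine; supplied by `stub_topologicalGap` in the
composition (`periodicStability_of_topologicalChargeGap`). -/
def PeriodicStability : Prop :=
  BddBelow (Set.range fun Q : PeriodicConfiguration 3 => Q.energyPerParticle Vχ)

/-- **METRICAL CHARGE GAP** (the line's deliverable): excess energy plus a crude allowance `C` per
topological site pays `κ` per metrical site — `N e_χ* + κ·#M − C·#T ≤ E_χ(y)` for every finite injective
`y`. Implied by the crux (`metricalChargeGap_of_truncatedCensusGap`, `C = 0`); expected `κ ~ 1e-5`
(threshold² × stiffness: Disproof §6 witnesses are `M`-configurations with `ΔE/#M = 2.7e-5`). -/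
def MetricalChargeGap : Prop :=
  ∃ κ C : ℝ, 0 < κ ∧ 0 ≤ C ∧ ∀ (N : ℕ) (y : Fin N → E³), Function.Injective y →
    (N : ℝ) * eStar + κ * (Nat.card {i : Fin N // IsMetr y i} : ℝ)
      - C * (Nat.card {j : Fin N // IsTopo y j} : ℝ) ≤ interactionEnergy Vχ y

/-- **TOPOLOGICAL CHARGE GAP** (the residual crux on the band `≥ 2 %`; other lines' mechanism):
`N e_χ* + κ'·#T ≤ E_χ(y)` for every finite injective `y`. Implied by the crux
(`topologicalChargeGap_of_truncatedCensusGap`); implies `PeriodicStability`; `κ' ≲ 1.1e-4` (a `2.01 %`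
compressed pair: `≈ 2.2e-3` for `≈ 20` T-sites, triage r1-2 finding 3). -/
def TopologicalChargeGap : Prop :=
  ∃ κ : ℝ, 0 < κ ∧ ∀ (N : ℕ) (y : Fin N → E³), Function.Injective y →
    (N : ℝ) * eStar + κ * (Nat.card {j : Fin N // IsTopo y j} : ℝ) ≤ interactionEnergy Vχ y

/-- The crux in the vocabulary of this file (definitionally `TruncatedCensusGap`, `censusGap_iff`); the
proved glue concludes THIS, and only `TruncatedCensusGap_of` concludes the route decl by name. -/
def CensusGap : Prop :=
  ∃ κ : ℝ, 0 < κ ∧ ∀ (N : ℕ) (y : Fin N → E³), Function.Injective y →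
    (N : ℝ) * eStar + κ * (Nat.card {i : Fin N // ¬ IsChargeFree (1 / 100 : ℝ) y i} : ℝ) ≤
      interactionEnergy Vχ y

theorem censusGap_iff : CensusGap ↔ TruncatedCensusGap := Iff.rfl

/-! ## §2 The registered stubs (`sorry` lives only in these five theorems)

Each registered `stub_*` restates its named statement of §1 VERBATIM over tree declarations (the local
kernels `kTan`/`kRad`/`hessV` and `Vχ`/`e_χ*` are inlined), so that the signature recorded by
`ledger skeleton check` is self-contained; the wiring `example` after `TruncatedCensusGap_of` certifies
that each restatement is definitionally the named statement. -/

/-- **STUB 1 · `stub_softLinkWindow`** (geometry, M–L) = `SoftLinkWindow`: the soft link theorem up to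
tolerance `1/50`. Falsifier: 12 points in the shell `[1, 1.02]`, pairwise `≥ 0.98`, 4-regular soft
contact graph, farther than `1/4` from both patterns. -/
theorem stub_softLinkWindow :
    ∀ η : ℝ, 0 < η → η ≤ 1 / 50 → ∀ (N : ℕ) (y : Fin N → EuclideanSpace ℝ (Fin 3)) (i : Fin N),
      IsChargeFree η y i →
      ∃ (A : EuclideanSpace ℝ (Fin 3) →ₗᵢ[ℝ] EuclideanSpace ℝ (Fin 3))
        (P : Finset (EuclideanSpace ℝ (Fin 3))), (P = fccKissingPattern ∨ P = hcpKissingPattern) ∧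
        ∀ p ∈ P, ∃ j : Fin N, dist (y j) (y i + nearestDist y i • A p) ≤ nearestDist y i / 4 := by
  sorry

/-- **STUB 2 · `stub_windowCharts`** (geometry, L) = `SoftLinkWindow → WindowCharts`: octet-truss
propagation of the soft link theorem to two-way `nn/6`-charts of radius `3·nn` under per-site tolerances
`≤ 1/50`. -/
theorem stub_windowCharts :
    (∀ η : ℝ, 0 < η → η ≤ 1 / 50 → ∀ (N : ℕ) (y : Fin N → EuclideanSpace ℝ (Fin 3)) (i : Fin N),
      IsChargeFree η y i →
      ∃ (A : EuclideanSpace ℝ (Fin 3) →ₗᵢ[ℝ] EuclideanSpace ℝ (Fin 3))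
        (P : Finset (EuclideanSpace ℝ (Fin 3))), (P = fccKissingPattern ∨ P = hcpKissingPattern) ∧
        ∀ p ∈ P, ∃ j : Fin N, dist (y j) (y i + nearestDist y i • A p) ≤ nearestDist y i / 4) →
    ∀ (N : ℕ) (y : Fin N → EuclideanSpace ℝ (Fin 3)) (i : Fin N),
      (∀ j : Fin N, dist (y i) (y j) ≤ 8 * nearestDist y i →
        ∃ η : ℝ, 0 < η ∧ η ≤ 1 / 50 ∧ IsChargeFree η y j) →
      ∃ (s : ℤ → ℤ) (g : EuclideanSpace ℝ (Fin 3) ≃ᵃⁱ[ℝ] EuclideanSpace ℝ (Fin 3)), IsHaggSeq s ∧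
        (∀ j : Fin N, dist (y i) (y j) ≤ 3 * nearestDist y i →
          ∃ z ∈ barlowStacking (nearestDist y i) (nearestDist y i * Real.sqrt (2 / 3)) s,
            dist (y j) (g z) ≤ nearestDist y i / 6) ∧
        ∀ z ∈ barlowStacking (nearestDist y i) (nearestDist y i * Real.sqrt (2 / 3)) s,
          dist (y i) (g z) ≤ 3 * nearestDist y i →
            ∃ j : Fin N, dist (y j) (g z) ≤ nearestDist y i / 6 := by
  sorry

/-- **STUB 3 · `stub_harmonicCoercivity`** (certified numerics, L) = `HarmonicCoercivity`: uniform
phonon coercivity of every Barlow polytype under `V_χ` on the scale window `[24/25, 99/100]`; the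
kernels `kTan = V_χ'/r`, `kRad = V_χ''`, `hessV` are inlined as `let`s. Falsifier: a Hägg word / scale
with a non-positive generalised Bloch eigenvalue of (Hessian form, nn-difference form). -/
theorem stub_harmonicCoercivity :
    let kTan : ℝ → ℝ := fun r =>
      if r < 3 / 2 then (-(r⁻¹) ^ 13 + (r⁻¹) ^ 7) / r
      else if r < 2 then (-2 * lennardJones r + (4 - 2 * r) * (-(r⁻¹) ^ 13 + (r⁻¹) ^ 7)) / r
      else 0
    let kRad : ℝ → ℝ := fun r =>
      if r < 3 / 2 then 13 * (r⁻¹) ^ 14 - 7 * (r⁻¹) ^ 8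
      else if r < 2 then
        -4 * (-(r⁻¹) ^ 13 + (r⁻¹) ^ 7) + (4 - 2 * r) * (13 * (r⁻¹) ^ 14 - 7 * (r⁻¹) ^ 8)
      else 0
    let hessV : EuclideanSpace ℝ (Fin 3) → EuclideanSpace ℝ (Fin 3) → ℝ := fun e w =>
      kRad ‖e‖ * (inner ℝ e w / ‖e‖) ^ 2 + kTan ‖e‖ * (‖w‖ ^ 2 - (inner ℝ e w / ‖e‖) ^ 2)
    ∃ κ : ℝ, 0 < κ ∧ ∀ s : ℤ → ℤ, IsHaggSeq s → ∀ a : ℝ, 24 / 25 ≤ a → a ≤ 99 / 100 →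
      ∀ u : EuclideanSpace ℝ (Fin 3) → EuclideanSpace ℝ (Fin 3), (Function.support u).Finite →
        Function.support u ⊆ barlowStacking a (a * Real.sqrt (2 / 3)) s →
        κ * (∑' p : barlowStacking a (a * Real.sqrt (2 / 3)) s,
              ∑' q : barlowStacking a (a * Real.sqrt (2 / 3)) s,
                if dist (p : EuclideanSpace ℝ (Fin 3)) q ≤ 11 / 10 * a then ‖u p - u q‖ ^ 2 else 0) ≤
          (∑' p : barlowStacking a (a * Real.sqrt (2 / 3)) s,
              ∑' q : barlowStacking a (a * Real.sqrt (2 / 3)) s,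
                if (p : EuclideanSpace ℝ (Fin 3)) ≠ q then
                  hessV ((p : EuclideanSpace ℝ (Fin 3)) - q) (u p - u q) else 0) / 2 := by
  sorry

/-- **STUB 4 · `stub_elasticPricing`** (analysis, XL — hardest stub proper to the line)
= `PeriodicStability → WindowCharts → HarmonicCoercivity → MetricalChargeGap`: discrete FJM rigidity
with defect allowance. Internal lemmas (line card): truss lock (linear metric control on charts),
equation of state along uniform scaling, first-order term = boundary flux at the layer-relaxed polytype,
harmonic ⇒ semi-global coercivity on the `O(η₁)` basin, threshold lever (`bondGraph_mono`, Disproof §6),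
packing count `K` per T-site at the LJ scale, Ruelle superstability for crowded sites. -/
theorem stub_elasticPricing :
    BddBelow (Set.range fun Q : PeriodicConfiguration 3 =>
      Q.energyPerParticle fun r => min 1 (max 0 (4 - 2 * r)) * lennardJones r) →
    (∀ (N : ℕ) (y : Fin N → EuclideanSpace ℝ (Fin 3)) (i : Fin N),
      (∀ j : Fin N, dist (y i) (y j) ≤ 8 * nearestDist y i →
        ∃ η : ℝ, 0 < η ∧ η ≤ 1 / 50 ∧ IsChargeFree η y j) →
      ∃ (s : ℤ → ℤ) (g : EuclideanSpace ℝ (Fin 3) ≃ᵃⁱ[ℝ] EuclideanSpace ℝ (Fin 3)), IsHaggSeq s ∧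
        (∀ j : Fin N, dist (y i) (y j) ≤ 3 * nearestDist y i →
          ∃ z ∈ barlowStacking (nearestDist y i) (nearestDist y i * Real.sqrt (2 / 3)) s,
            dist (y j) (g z) ≤ nearestDist y i / 6) ∧
        ∀ z ∈ barlowStacking (nearestDist y i) (nearestDist y i * Real.sqrt (2 / 3)) s,
          dist (y i) (g z) ≤ 3 * nearestDist y i →
            ∃ j : Fin N, dist (y j) (g z) ≤ nearestDist y i / 6) →
    (let kTan : ℝ → ℝ := fun r =>
      if r < 3 / 2 then (-(r⁻¹) ^ 13 + (r⁻¹) ^ 7) / r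
      else if r < 2 then (-2 * lennardJones r + (4 - 2 * r) * (-(r⁻¹) ^ 13 + (r⁻¹) ^ 7)) / r
      else 0
    let kRad : ℝ → ℝ := fun r =>
      if r < 3 / 2 then 13 * (r⁻¹) ^ 14 - 7 * (r⁻¹) ^ 8
      else if r < 2 then
        -4 * (-(r⁻¹) ^ 13 + (r⁻¹) ^ 7) + (4 - 2 * r) * (13 * (r⁻¹) ^ 14 - 7 * (r⁻¹) ^ 8)
      else 0
    let hessV : EuclideanSpace ℝ (Fin 3) → EuclideanSpace ℝ (Fin 3) → ℝ := fun e w =>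
      kRad ‖e‖ * (inner ℝ e w / ‖e‖) ^ 2 + kTan ‖e‖ * (‖w‖ ^ 2 - (inner ℝ e w / ‖e‖) ^ 2)
    ∃ κ : ℝ, 0 < κ ∧ ∀ s : ℤ → ℤ, IsHaggSeq s → ∀ a : ℝ, 24 / 25 ≤ a → a ≤ 99 / 100 →
      ∀ u : EuclideanSpace ℝ (Fin 3) → EuclideanSpace ℝ (Fin 3), (Function.support u).Finite →
        Function.support u ⊆ barlowStacking a (a * Real.sqrt (2 / 3)) s →
        κ * (∑' p : barlowStacking a (a * Real.sqrt (2 / 3)) s,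
              ∑' q : barlowStacking a (a * Real.sqrt (2 / 3)) s,
                if dist (p : EuclideanSpace ℝ (Fin 3)) q ≤ 11 / 10 * a then ‖u p - u q‖ ^ 2 else 0) ≤
          (∑' p : barlowStacking a (a * Real.sqrt (2 / 3)) s,
              ∑' q : barlowStacking a (a * Real.sqrt (2 / 3)) s,
                if (p : EuclideanSpace ℝ (Fin 3)) ≠ q then
                  hessV ((p : EuclideanSpace ℝ (Fin 3)) - q) (u p - u q) else 0) / 2) →
    ∃ κ C : ℝ, 0 < κ ∧ 0 ≤ C ∧ ∀ (N : ℕ) (y : Fin N → EuclideanSpace ℝ (Fin 3)),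
      Function.Injective y →
      (N : ℝ) * (⨅ Q : PeriodicConfiguration 3,
          Q.energyPerParticle fun r => min 1 (max 0 (4 - 2 * r)) * lennardJones r)
        + κ * (Nat.card {i : Fin N // ¬ IsChargeFree (1 / 100 : ℝ) y i ∧
            ∃ η ∈ Set.Icc (1 / 100 : ℝ) (1 / 50), IsChargeFree η y i} : ℝ)
        - C * (Nat.card {j : Fin N // ∀ η ∈ Set.Icc (1 / 100 : ℝ) (1 / 50), ¬ IsChargeFree η y j} : ℝ)
      ≤ interactionEnergy (fun r => min 1 (max 0 (4 - 2 * r)) * lennardJones r) y := by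
  sorry

/-- **STUB 5 · `stub_topologicalGap`** (XL, the residual open content; imported from the census /
sharp-m-potential line, not attacked here) = `TopologicalChargeGap`: the topological charge gap. -/
theorem stub_topologicalGap :
    ∃ κ : ℝ, 0 < κ ∧ ∀ (N : ℕ) (y : Fin N → EuclideanSpace ℝ (Fin 3)), Function.Injective y →
      (N : ℝ) * (⨅ Q : PeriodicConfiguration 3,
          Q.energyPerParticle fun r => min 1 (max 0 (4 - 2 * r)) * lennardJones r)
        + κ * (Nat.card {j : Fin N // ∀ η ∈ Set.Icc (1 / 100 : ℝ) (1 / 50), ¬ IsChargeFree η y j} : ℝ)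
      ≤ interactionEnergy (fun r => min 1 (max 0 (4 - 2 * r)) * lennardJones r) y := by
  sorry

/-! ### Consistency: each registered stub IS its named statement (definitionally) -/

theorem softLinkWindow_holds : SoftLinkWindow := stub_softLinkWindow
theorem windowCharts_holds : SoftLinkWindow → WindowCharts := stub_windowCharts
theorem harmonicCoercivity_holds : HarmonicCoercivity := stub_harmonicCoercivity
theorem elasticPricing_holds :
    PeriodicStability → WindowCharts → HarmonicCoercivity → MetricalChargeGap := stub_elasticPricing
theorem topologicalGap_holds : TopologicalChargeGap := stub_topologicalGap

/-! ### Audit names of the stub statements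

`Goal.stub_x` abbreviates the statement of the registered stub `stub_x`, so that the skeleton audit
(`#h21_check_skeleton`, by-name policy on hypothesis heads) reads the hypotheses of
`TruncatedCensusGap_of` as exactly the five declared stubs. -/

namespace Goal

/-- Statement of STUB 1 `stub_softLinkWindow`. -/
abbrev stub_softLinkWindow : Prop := SoftLinkWindow
/-- Statement of STUB 2 `stub_windowCharts`. -/
abbrev stub_windowCharts : Prop := SoftLinkWindow → WindowCharts
/-- Statement of STUB 3 `stub_harmonicCoercivity`. -/
abbrev stub_harmonicCoercivity : Prop := HarmonicCoercivity
/-- Statement of STUB 4 `stub_elasticPricing`. -/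
abbrev stub_elasticPricing : Prop :=
  PeriodicStability → WindowCharts → HarmonicCoercivity → MetricalChargeGap
/-- Statement of STUB 5 `stub_topologicalGap`. -/
abbrev stub_topologicalGap : Prop := TopologicalChargeGap

end Goal

/-! ## §3 Proved glue (sorry-free) -/

/-- The T-gap forces periodic stability of `V_χ` (Disproof §3 against the T-set): otherwise `e_χ* = 0`
by the `Real.iInf` convention and the two-point configuration `{0, e₀}` (energy `−1/12`) violates it. -/
theorem periodicStability_of_topologicalChargeGap (hT : TopologicalChargeGap) : PeriodicStability := by
  obtain ⟨κ, hκ, h⟩ := hT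
  by_contra hB
  have h0 : eStar = 0 := Real.iInf_of_not_bddBelow hB
  have h2 := h 2 _ injective_pair_zero_single
  have hE : interactionEnergy Vχ ![(0 : E³), EuclideanSpace.single 0 1] = -1 / 12 :=
    interactionEnergy_truncLJ_pair
  rw [h0, hE] at h2
  have hk : (0 : ℝ) ≤
      κ * (Nat.card {j : Fin 2 // IsTopo ![(0 : E³), EuclideanSpace.single 0 1] j} : ℝ) :=
    mul_nonneg hκ.le (Nat.cast_nonneg _)
  push_cast at h2
  linarith

/-- **The exact count**: `#charged(1/100) = #M + #T` — every charged site is charge-free at some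
tolerance of the window or at none, and a T-site is charged at `1/100 ∈ [1/100, 1/50]`. -/
theorem card_charged_eq {N : ℕ} (y : Fin N → E³) :
    Nat.card {i : Fin N // ¬ IsChargeFree (1 / 100 : ℝ) y i} =
      Nat.card {i : Fin N // IsMetr y i} + Nat.card {j : Fin N // IsTopo y j} := by
  classical
  rw [Nat.card_eq_fintype_card, Nat.card_eq_fintype_card, Nat.card_eq_fintype_card,
    Fintype.card_subtype, Fintype.card_subtype, Fintype.card_subtype,
    ← Finset.card_filter_add_card_filter_not
      (fun i : Fin N => ∃ η ∈ Set.Icc (1 / 100 : ℝ) (1 / 50), IsChargeFree η y i),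
    Finset.filter_filter, Finset.filter_filter]
  congr 1
  · exact congrArg Finset.card (Finset.filter_congr fun i _ => Iff.rfl)
  · refine congrArg Finset.card (Finset.filter_congr fun i _ => ⟨?_, ?_⟩)
    · rintro ⟨-, h⟩ η hη hc
      exact h ⟨η, hη, hc⟩
    · intro h
      exact ⟨h (1 / 100) ⟨le_rfl, by norm_num⟩, fun ⟨η, hη, hc⟩ => h η hη hc⟩

/-- **The convex combination** (the idea card's `ChargeSplitting`, now pure algebra):
`λ·(M-gap) + (1−λ)·(T-gap)` with `λ = κ'/(2(κ'+C))` gives `N e* + λκ·#M + (κ'/2)·#T ≤ E`, and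
`#charged = #M + #T`. -/
theorem censusGap_of_gaps (hM : MetricalChargeGap) (hT : TopologicalChargeGap) : CensusGap := by
  obtain ⟨κ, C, hκ, hC, hM⟩ := hM
  obtain ⟨κ', hκ', hT⟩ := hT
  have hden : 0 < 2 * (κ' + C) := by positivity
  obtain ⟨l, hl⟩ : ∃ l : ℝ, l = κ' / (2 * (κ' + C)) := ⟨_, rfl⟩
  have hl0 : 0 < l := by rw [hl]; exact div_pos hκ' hden
  have hl1 : l ≤ 1 := by
    rw [hl, div_le_one hden]
    linarith
  have hlid : l * (κ' + C) = κ' / 2 := by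
    rw [hl, div_mul_eq_mul_div, div_eq_iff hden.ne']
    ring
  have hlid' : l * κ' + l * C = κ' / 2 := by
    rw [← hlid]
    ring
  refine ⟨min (l * κ) (κ' / 2), lt_min (mul_pos hl0 hκ) (half_pos hκ'), fun N y hy => ?_⟩
  have h1 := hM N y hy
  have h2 := hT N y hy
  have hsum : (Nat.card {i : Fin N // ¬ IsChargeFree (1 / 100 : ℝ) y i} : ℝ) =
      (Nat.card {i : Fin N // IsMetr y i} : ℝ) + (Nat.card {j : Fin N // IsTopo y j} : ℝ) := by
    exact_mod_cast card_charged_eq y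
  rw [hsum]
  have hm0 : (0 : ℝ) ≤ (Nat.card {i : Fin N // IsMetr y i} : ℝ) := Nat.cast_nonneg _
  have ht0 : (0 : ℝ) ≤ (Nat.card {j : Fin N // IsTopo y j} : ℝ) := Nat.cast_nonneg _
  have e1 := mul_le_mul_of_nonneg_left h1 hl0.le
  have e2 := mul_le_mul_of_nonneg_left h2 (by linarith : (0 : ℝ) ≤ 1 - l)
  have hco : κ' / 2 = κ' - (l * κ' + l * C) := by linarith [hlid']
  have key : (N : ℝ) * eStar + l * κ * (Nat.card {i : Fin N // IsMetr y i} : ℝ)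
      + κ' / 2 * (Nat.card {j : Fin N // IsTopo y j} : ℝ) ≤ interactionEnergy Vχ y := by
    calc (N : ℝ) * eStar + l * κ * (Nat.card {i : Fin N // IsMetr y i} : ℝ)
          + κ' / 2 * (Nat.card {j : Fin N // IsTopo y j} : ℝ)
        = l * ((N : ℝ) * eStar + κ * (Nat.card {i : Fin N // IsMetr y i} : ℝ)
              - C * (Nat.card {j : Fin N // IsTopo y j} : ℝ))
          + (1 - l) * ((N : ℝ) * eStar + κ' * (Nat.card {j : Fin N // IsTopo y j} : ℝ)) := by
          rw [hco]; ring
      _ ≤ l * interactionEnergy Vχ y + (1 - l) * interactionEnergy Vχ y := add_le_add e1 e2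
      _ = interactionEnergy Vχ y := by ring
  have hmin1 : min (l * κ) (κ' / 2) * (Nat.card {i : Fin N // IsMetr y i} : ℝ) ≤
      l * κ * (Nat.card {i : Fin N // IsMetr y i} : ℝ) :=
    mul_le_mul_of_nonneg_right (min_le_left _ _) hm0
  have hmin2 : min (l * κ) (κ' / 2) * (Nat.card {j : Fin N // IsTopo y j} : ℝ) ≤
      κ' / 2 * (Nat.card {j : Fin N // IsTopo y j} : ℝ) :=
    mul_le_mul_of_nonneg_right (min_le_right _ _) ht0
  calc (N : ℝ) * eStar + min (l * κ) (κ' / 2) *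
        ((Nat.card {i : Fin N // IsMetr y i} : ℝ) + (Nat.card {j : Fin N // IsTopo y j} : ℝ))
      = (N : ℝ) * eStar + (min (l * κ) (κ' / 2) * (Nat.card {i : Fin N // IsMetr y i} : ℝ)
          + min (l * κ) (κ' / 2) * (Nat.card {j : Fin N // IsTopo y j} : ℝ)) := by ring
    _ ≤ (N : ℝ) * eStar + (l * κ * (Nat.card {i : Fin N // IsMetr y i} : ℝ)
          + κ' / 2 * (Nat.card {j : Fin N // IsTopo y j} : ℝ)) := by linarith
    _ ≤ interactionEnergy Vχ y := by linarith [key]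

/-! ## §4 The skeleton theorem: the five stubs give the crux BY NAME -/

/-- **`TruncatedCensusGap_of`** — periodic stability from the T-gap; window charts from the soft link
theorem; the M-gap from the elastic engine; then `censusGap_of_gaps`. -/
theorem TruncatedCensusGap_of (h₁ : Goal.stub_softLinkWindow) (h₂ : Goal.stub_windowCharts)
    (h₃ : Goal.stub_harmonicCoercivity) (h₄ : Goal.stub_elasticPricing)
    (h₅ : Goal.stub_topologicalGap) :
    Summit.AtomisticToContinuum.Crystallization.Theses.PricedLinkCensus.TruncatedCensusGap :=
  censusGap_iff.mp
    (censusGap_of_gaps (h₄ (periodicStability_of_topologicalChargeGap h₅) (h₂ h₁) h₃) h₅)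

/-- Wiring check: the registered stubs feed `TruncatedCensusGap_of` as stated. -/
example : Summit.AtomisticToContinuum.Crystallization.Theses.PricedLinkCensus.TruncatedCensusGap :=
  TruncatedCensusGap_of stub_softLinkWindow stub_windowCharts stub_harmonicCoercivity
    stub_elasticPricing stub_topologicalGap

/-! ## §5 Calibration (sorry-free): the split loses no strength; the geometric stubs extend route items -/

/-- The crux implies the M-gap (with `C = 0`: `#M ≤ #charged`). -/
theorem metricalChargeGap_of_truncatedCensusGap (h : TruncatedCensusGap) : MetricalChargeGap := by
  obtain ⟨κ, hκ, h⟩ := h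
  refine ⟨κ, 0, hκ, le_rfl, fun N y hy => ?_⟩
  have h1 : (N : ℝ) * eStar + κ * (Nat.card {i : Fin N // ¬ IsChargeFree (1 / 100 : ℝ) y i} : ℝ) ≤
      interactionEnergy Vχ y := h N y hy
  have hle : Nat.card {i : Fin N // IsMetr y i} ≤
      Nat.card {i : Fin N // ¬ IsChargeFree (1 / 100 : ℝ) y i} :=
    Nat.card_le_card_of_injective _
      (Subtype.impEmbedding _ _ fun i (hi : IsMetr y i) => hi.1).injective
  have hle' : κ * (Nat.card {i : Fin N // IsMetr y i} : ℝ) ≤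
      κ * (Nat.card {i : Fin N // ¬ IsChargeFree (1 / 100 : ℝ) y i} : ℝ) :=
    mul_le_mul_of_nonneg_left (by exact_mod_cast hle) hκ.le
  have ht0 : (0 : ℝ) ≤ (Nat.card {j : Fin N // IsTopo y j} : ℝ) := Nat.cast_nonneg _
  linarith

/-- The crux implies the T-gap (`#T ≤ #charged`: a T-site is charged at `1/100`). -/
theorem topologicalChargeGap_of_truncatedCensusGap (h : TruncatedCensusGap) :
    TopologicalChargeGap := by
  obtain ⟨κ, hκ, h⟩ := h
  refine ⟨κ, hκ, fun N y hy => ?_⟩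
  have h1 : (N : ℝ) * eStar + κ * (Nat.card {i : Fin N // ¬ IsChargeFree (1 / 100 : ℝ) y i} : ℝ) ≤
      interactionEnergy Vχ y := h N y hy
  have hle : Nat.card {j : Fin N // IsTopo y j} ≤
      Nat.card {i : Fin N // ¬ IsChargeFree (1 / 100 : ℝ) y i} :=
    Nat.card_le_card_of_injective _
      (Subtype.impEmbedding _ _ fun j (hj : IsTopo y j) =>
        hj (1 / 100) ⟨le_rfl, by norm_num⟩).injective
  have hle' : κ * (Nat.card {j : Fin N // IsTopo y j} : ℝ) ≤
      κ * (Nat.card {i : Fin N // ¬ IsChargeFree (1 / 100 : ℝ) y i} : ℝ) :=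
    mul_le_mul_of_nonneg_left (by exact_mod_cast hle) hκ.le
  linarith

/-- Hence the two energy stubs are JOINTLY EQUIVALENT to the crux. -/
theorem censusGap_iff_gaps : TruncatedCensusGap ↔ MetricalChargeGap ∧ TopologicalChargeGap :=
  ⟨fun h => ⟨metricalChargeGap_of_truncatedCensusGap h, topologicalChargeGap_of_truncatedCensusGap h⟩,
    fun h => censusGap_iff.mp (censusGap_of_gaps h.1 h.2)⟩

/-- STUB 1 extends route item 14234: `SoftLinkWindow → SoftFourRings` (tolerances `≤ 1/100 ≤ 1/50`). -/
theorem softFourRings_of_softLinkWindow (h : SoftLinkWindow) : SoftFourRings :=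
  fun η hη hη1 N y i hi => h η hη (hη1.trans (by norm_num)) N y i hi

/-- `WindowCharts` extends route item 14233: `WindowCharts → SoftLayerPropagation` (one tolerance
`η ≤ 1/100` for all sites is a per-site tolerance `≤ 1/50`). -/
theorem softLayerPropagation_of_windowCharts (h : WindowCharts) : SoftLayerPropagation :=
  fun η hη hη1 N y i hall => h N y i fun j hj => ⟨η, hη, hη1.trans (by norm_num), hall j hj⟩

end Summit.AtomisticToContinuum.Crystallization.Cruxes.TruncatedCensusGap.MetricalChargeCoercivity

end
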